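import Summits.BirchSwinnertonDyer.Rank1Residual.Additive.CyclotomicTowerSignedSelmer
import Literature.NumberTheory.GaloisRepresentations.CyclotomicCharacterSurjectiveProofs
import Mathlib.NumberTheory.Cyclotomic.Basic
import Mathlib.RingTheory.Polynomial.Eisenstein.IsIntegral
import Mathlib.RingTheory.Polynomial.Cyclotomic.Eval
import Mathlib.RingTheory.Polynomial.GaussLemma
import Mathlib.NumberTheory.Padics.PadicIntegers
import HarnessLib

/-!
# (P5-0) The local Galois input at `p` of the signed-`η` twist dictionary: the decomposition
# group of `Γ_ℚ` at the model `ℚ_[p]` surjects onto `Gal(K₀·ℚ_∞/ℚ)`, `K₀ = ℚ(μ_p)`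
(cell `b2b-bsdres`, team n1011, seat n1011-p17 GEN 7; row T-O7ss-P13 follow-up (P5), file P5-0 of
`cells/n1011/skel/T-O7ss-P5.md` §2 (D0); lead GEN 7 R5-68 (n): P5-0 ONLY, theorems only)

HONEST FRAMING (cell `b2b-bsdres`, run/shared/lean/b2b/bsd-rank1-residual/, verbatim in every
file): the goal of the cell is to DELETE the COMBINATION-SHAPED residual classes of the
Birch–Swinnerton-Dyer formula for ALL analytic-rank `≤ 1` elliptic curves over `ℚ` — "full BSD
formula for every rank `≤ 1` curve in class `C`" assembled STRICTLY from published theorems — so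
that the rank-`≤ 1` remainder becomes exactly the CONSTRUCTION-SHAPED classes, which are TYPED
(missing-input `Prop`s), NOT attempted. This is not "finishing BSD". Research route on
O7-ss ∩ (G)∧ss ∩ e = 2 (OPEN) / X4 CONSTRUCTION-SHAPED; nothing here is booked; no label moves.
TOOL THEOREMS ONLY: no definition, no named Literature fact, no `sorry`; axioms standard.

## What is proved (local Galois theory at `p`; the ONLY arithmetic input of the (P5) dictionary)

For a prime `p`, the cyclotomic `ℤ_p`-extension `κ` of `ℚ` (`ZpExtension.IsCyclotomic`:
`ker κ = χ_p⁻¹(μ(ℤ_p))`) and a `p`-th cyclotomic field `K₀` (`IsCyclotomicExtension {p} ℚ K₀`;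
Kobayashi's `K_∞ = K₀·ℚ_∞ = ℚ(μ_{p^∞})`, `Gal(ℚ̄/K_∞) = towerTopSubgroup κ K₀ = ker κ ⊓ Gal(ℚ̄/K₀)`):

* `irreducible_cyclotomic_prime_pow_padic` — `Φ_{pⁿ}` is irreducible over `ℚ_p` (Mathlib's
  Eisenstein criterion for `Φ_{p^{n+1}}(X+1)` over `ℤ`, mapped to `ℤ_p`, Gauss's lemma for the
  integrally closed domain `ℤ_p ⊂ ℚ_p`, and the substitution `X ↦ X + 1`);
* `cyclotomicCharacter_surjective_of_prime_pow` — over a field of characteristic `0` on which all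
  `Φ_{pⁿ}` are irreducible the `p`-adic cyclotomic character `χ_p : Γ_K →ₜ* ℤ_pˣ` is onto (the
  tree's `GaloisRep.cyclotomicCharacter_surjective` verbatim, whose proof uses irreducibility at
  prime-power levels only); hence `cyclotomicCharacter_padic_surjective` for `K = ℚ_p`
  ("`ℚ_p(μ_{p^∞})/ℚ_p` has group `ℤ_pˣ`", i.e. `ℚ(μ_{p^∞})/ℚ` is totally ramified at `p`);
* `cyclotomicCharacter_resGalOfEmb` — `χ_p^K ∘ res_ι = χ_p^E` for the restriction
  `res_ι : Γ_E → Γ_K` along a `K`-embedding `ι : K̄ → Ē` (uniqueness of `χ_p`);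
* `mem_galRange_of_cyclotomicCharacter_eq_one`, `mem_towerTopSubgroup_of_cyclotomicCharacter_eq_one`
  — `ker χ_p ≤ Gal(ℚ̄/K₀)` (`K₀` and all its conjugates are generated by `p`-th roots of unity)
  and `ker χ_p ≤ ker κ ⊓ Gal(ℚ̄/K₀)`;
* `localTowerHyp_padic` — (D0) of the skeleton in UNFOLDED form: for every `g ∈ Γ_ℚ` there is
  `τ ∈ Γ_{ℚ_p}` with `res(τ)⁻¹ g ∈ towerTopSubgroup κ K₀`, i.e. the decomposition group of the
  chosen embedding `closureEmb ℚ_[p] : ℚ̄ → ℚ̄_p` surjects onto `Γ_ℚ / Gal(ℚ̄/K₀ℚ_∞) = Gal(ℚ(μ_{p^∞})/ℚ)`.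

No `p ≠ 2`, no parity, no CM hypothesis; nothing about elliptic curves is used.

References: J. Neukirch, *Algebraic Number Theory* (1999), Ch. II Prop. (7.13) (`ℚ_p(ζ_{p^m})/ℚ_p`
totally ramified of degree `φ(p^m)`); J.-P. Serre, *Local Fields*, Ch. IV §4, Prop. 17;
L. Washington, *Introduction to Cyclotomic Fields* (1997), §13.1, Ch. 14 p. 321; S. Kobayashi,
Invent. Math. 152 (2003) [Kobayashi2003], §2 p. 4 ("the prime `p` is totally ramified in `K_n`").
-/

noncomputable section

open scoped Classical

open Polynomial Field

universe u

namespace Summit.BirchSwinnertonDyer.Rank1Residual.Additive.SignedTwist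

open Literature.NumberTheory.EllipticCurves Literature.NumberTheory.GaloisRepresentations
  ZpExtension

/-! ## §1 `Φ_{pⁿ}` is irreducible over `ℚ_p` -/

section Irreducible

variable (p : ℕ) [Fact p.Prime]

/-- The constant coefficient of `Φ_{p^{n+1}}(X + 1) ∈ ℤ[X]` is `Φ_{p^{n+1}}(1) = p`.
[cite: Washington1997, Ch. 2 (proof of Prop. 2.1: `Φ_{p^{n+1}}(1) = p`)] -/
theorem coeff_zero_cyclotomic_prime_pow_comp_X_add_one (n : ℕ) :
    ((cyclotomic (p ^ (n + 1)) ℤ).comp (X + 1)).coeff 0 = p := by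
  rw [coeff_zero_eq_eval_zero, eval_comp, eval_add, eval_X, eval_one, zero_add,
    eval_one_cyclotomic_prime_pow]

/-- **`Φ_{pⁿ}` is irreducible over `ℚ_p`** (equivalently `[ℚ_p(ζ_{pⁿ}) : ℚ_p] = φ(pⁿ)`,
`ℚ_p(ζ_{pⁿ})/ℚ_p` totally ramified): `Φ_{p^{n+1}}(X + 1)` is Eisenstein at `p` over `ℤ`
(Mathlib `cyclotomic_prime_pow_comp_X_add_one_isEisensteinAt`), hence Eisenstein at `(p)` over
`ℤ_p`, hence irreducible over `ℤ_p` and, by Gauss's lemma, over `ℚ_p = Frac ℤ_p`.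
[cite: NeukirchANT1999, Ch. II Prop. (7.13)] -/
theorem irreducible_cyclotomic_prime_pow_padic (n : ℕ) :
    Irreducible (cyclotomic (p ^ n) ℚ_[p]) := by
  have hp : p.Prime := Fact.out
  rcases n with _ | n
  · rw [pow_zero, cyclotomic_one]
    exact irreducible_X_sub_C 1
  -- the Eisenstein polynomial `Φ_{p^{n+1}}(X+1)` over `ℤ`, mapped to `ℤ_[p]`
  set g : ℤ[X] := (cyclotomic (p ^ (n + 1)) ℤ).comp (X + 1) with hg
  have hX1 : (X + 1 : ℤ[X]) = X + C 1 := by rw [map_one]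
  have hgm : g.Monic := by
    rw [hg, hX1]
    exact (cyclotomic.monic _ ℤ).comp (monic_X_add_C 1) (by
      rw [natDegree_X_add_C]; exact one_ne_zero)
  have hgdeg : 0 < g.natDegree := by
    rw [hg, hX1, natDegree_comp, natDegree_X_add_C, mul_one, natDegree_cyclotomic]
    exact Nat.totient_pos.mpr (pow_pos hp.pos _)
  have hE := cyclotomic_prime_pow_comp_X_add_one_isEisensteinAt p n
  set f : ℤ_[p][X] := g.map (Int.castRingHom ℤ_[p]) with hf
  have hfm : f.Monic := hgm.map _
  have hfdeg : f.natDegree = g.natDegree := hgm.natDegree_map _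
  have hp0 : (p : ℤ_[p]) ≠ 0 := Nat.cast_ne_zero.mpr hp.ne_zero
  have hPprime : (Ideal.span {(p : ℤ_[p])}).IsPrime :=
    (Ideal.span_singleton_prime hp0).mpr PadicInt.prime_p
  have hfE : f.IsEisensteinAt (Ideal.span {(p : ℤ_[p])}) := by
    refine hfm.isEisensteinAt_of_mem_of_notMem hPprime.ne_top ?_ ?_
    · intro i hi
      rw [hf, coeff_map, Ideal.mem_span_singleton]
      have hi' : i < g.natDegree := hfdeg ▸ hi
      have hmem : g.coeff i ∈ Ideal.span {(p : ℤ)} := hE.mem hi'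
      obtain ⟨c, hc⟩ := Ideal.mem_span_singleton.mp hmem
      exact ⟨Int.castRingHom ℤ_[p] c, by rw [hc, map_mul, map_natCast]⟩
    · rw [hf, coeff_map, hg, coeff_zero_cyclotomic_prime_pow_comp_X_add_one, map_natCast,
        Ideal.span_singleton_pow, Ideal.mem_span_singleton]
      rintro ⟨c, hc⟩
      have h1 : (p : ℤ_[p]) * (p * c) = p * 1 := by
        rw [mul_one, ← mul_assoc, ← sq]; exact hc.symm
      exact PadicInt.irreducible_p.not_isUnit (IsUnit.of_mul_eq_one _ (mul_left_cancel₀ hp0 h1))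
  have hfirr : Irreducible f := hfE.irreducible hPprime hfm.isPrimitive (hfdeg ▸ hgdeg)
  have hfirr' : Irreducible (f.map (algebraMap ℤ_[p] ℚ_[p])) :=
    (hfm.irreducible_iff_irreducible_map_fraction_map (K := ℚ_[p])).mp hfirr
  have hfmap : f.map (algebraMap ℤ_[p] ℚ_[p]) = (cyclotomic (p ^ (n + 1)) ℚ_[p]).comp (X + 1) := by
    rw [hf, hg, Polynomial.map_map, map_comp, map_cyclotomic, Polynomial.map_add, map_X,
      Polynomial.map_one]
  rw [hfmap] at hfirr'
  -- undo the substitution `X ↦ X + 1`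
  have key : algEquivAevalXAddC (1 : ℚ_[p]) (cyclotomic (p ^ (n + 1)) ℚ_[p]) =
      (cyclotomic (p ^ (n + 1)) ℚ_[p]).comp (X + 1) := by
    rw [algEquivAevalXAddC_apply, comp_eq_aeval, map_one]
  rw [← key] at hfirr'
  exact (MulEquiv.irreducible_iff (algEquivAevalXAddC (1 : ℚ_[p]))).mp hfirr'

end Irreducible

/-! ## §2 Surjectivity of `χ_p` from irreducibility of the `Φ_{pⁿ}` only; the case `K = ℚ_p` -/

section Surjective

variable (K : Type u) [Field K] [CharZero K] (p : ℕ) [Fact p.Prime]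

/-- **Surjectivity of the `p`-adic cyclotomic character from the irreducibility of the `Φ_{pⁿ}`.**
If every `Φ_{pʲ}` is irreducible over the characteristic-`0` field `K`, then
`χ_p : Γ_K →ₜ* ℤ_pˣ` is onto: its image is closed (compactness of `Γ_K`) and meets every
residue class modulo `pʲ` (`Gal(K(μ_{pʲ})/K) ≃ (ℤ/pʲ)ˣ`). This is the tree's
`GaloisRep.cyclotomicCharacter_surjective` with its hypothesis weakened to what its proof uses.
[cite: Washington1997, Ch. 14, p. 321] -/
theorem cyclotomicCharacter_surjective_of_prime_pow
    (hirr : ∀ j : ℕ, Irreducible (cyclotomic (p ^ j) K)) :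
    Function.Surjective (GaloisRep.cyclotomicCharacter K p) := by
  classical
  have hp : p.Prime := Fact.out
  haveI : NeZero p := ⟨hp.ne_zero⟩
  intro u
  let Z : ℕ → Set (absoluteGaloisGroup K) := fun j =>
    {σ | ∀ ζ : AlgebraicClosure K, ζ ^ p ^ j = 1 →
      σ • ζ = ζ ^ (PadicInt.toZModPow j (u : ℤ_[p])).val}
  have hZclosed : ∀ j, IsClosed (Z j) := fun j =>
    RootOfUnityAction.isClosed_setOf_forall_smul_eq (p ^ j)
      fun ζ => ζ ^ (PadicInt.toZModPow j (u : ℤ_[p])).val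
  have hZanti : ∀ j, Z (j + 1) ⊆ Z j := by
    intro j σ hσ ζ hζ
    have hζ' : ζ ^ p ^ (j + 1) = 1 := by rw [pow_succ, pow_mul, hζ, one_pow]
    rw [hσ ζ hζ', pow_eq_pow_mod _ hζ, pow_eq_pow_mod (PadicInt.toZModPow j (u : ℤ_[p])).val hζ]
    congr 1
    rw [← ZMod.natCast_eq_natCast_iff', ZMod.natCast_val, ZMod.natCast_zmod_val,
      PadicInt.cast_toZModPow j (j + 1) (Nat.le_succ j)]
  have hZne : ∀ j, (Z j).Nonempty := by
    intro j
    haveI : NeZero (p ^ j) := ⟨pow_ne_zero _ hp.ne_zero⟩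
    obtain ⟨σ, hσA, -⟩ := RootOfUnityAction.exists_smul_eq_pow_and_smul_eq_self (K := K) (B := 1)
      (Nat.coprime_one_right _) (by rw [mul_one]; exact hirr j)
      (Units.map (PadicInt.toZModPow j).toMonoidHom u)
    exact ⟨σ, hσA⟩
  obtain ⟨σ, hσ⟩ := IsCompact.nonempty_iInter_of_sequence_nonempty_isCompact_isClosed Z hZanti
    hZne (hZclosed 0).isCompact hZclosed
  rw [Set.mem_iInter] at hσ
  refine ⟨σ, Units.ext (PadicInt.ext_of_toZModPow.mp fun n => ?_)⟩
  rw [GaloisRep.cyclotomicCharacter_apply, cyclotomicCharacter.toZModPow]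
  symm
  refine modularCyclotomicCharacter.unique (AlgebraicClosure K) _ _ (fun t ht => ?_)
  have ht' : ((t : (AlgebraicClosure K)ˣ) : AlgebraicClosure K) ^ p ^ n = 1 := by
    have := congrArg Units.val ((mem_rootsOfUnity _ t).mp ht)
    simpa using this
  exact hσ n _ ht'

/-- **`χ_p : Γ_{ℚ_p} →ₜ* ℤ_pˣ` is onto**: `Gal(ℚ_p(μ_{p^∞})/ℚ_p) ≃ ℤ_pˣ`, i.e. `ℚ(μ_{p^∞})/ℚ` is
totally ramified at `p` (`irreducible_cyclotomic_prime_pow_padic` +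
`cyclotomicCharacter_surjective_of_prime_pow`).
[cite: SerreLocalFields1979, Ch. IV §4, Prop. 17] [cite: NeukirchANT1999, Ch. II Prop. (7.13)] -/
theorem cyclotomicCharacter_padic_surjective :
    Function.Surjective (GaloisRep.cyclotomicCharacter ℚ_[p] p) :=
  cyclotomicCharacter_surjective_of_prime_pow ℚ_[p] p (irreducible_cyclotomic_prime_pow_padic p)

end Surjective

/-! ## §3 `χ_p` is compatible with restriction along an embedding of algebraic closures -/

section Restriction

variable {K : Type u} [Field K] [CharZero K] {E : Type u} [Field E] [Algebra K E]
  (ι : AlgebraicClosure K →ₐ[K] AlgebraicClosure E) (p : ℕ) [Fact p.Prime]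

/-- **`χ_p^K (res_ι τ) = χ_p^E τ`**: the `p`-adic cyclotomic character of `K` composed with the
restriction `res_ι : Γ_E → Γ_K` along a `K`-embedding `ι : K̄ → Ē` is the `p`-adic cyclotomic
character of `E` (`ι` maps `μ_{p^∞}(K̄)` onto `μ_{p^∞}(Ē)` and `ι ∘ res_ι(τ) = τ ∘ ι`;
uniqueness of `χ_p`). [cite: SerreAbelianLadic1968, Ch. I §1.2] -/
theorem cyclotomicCharacter_resGalOfEmb (τ : absoluteGaloisGroup E) :
    GaloisRep.cyclotomicCharacter K p (resGalOfEmb ι τ) = GaloisRep.cyclotomicCharacter E p τ := by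
  have hp : p.Prime := Fact.out
  haveI : CharZero E := charZero_of_injective_algebraMap (algebraMap K E).injective
  haveI : NeZero (p : E) := ⟨Nat.cast_ne_zero.mpr hp.ne_zero⟩
  refine Units.ext (PadicInt.ext_of_toZModPow.mp fun n => ?_)
  rw [GaloisRep.cyclotomicCharacter_apply K, cyclotomicCharacter.toZModPow]
  symm
  refine modularCyclotomicCharacter.unique (AlgebraicClosure K) _ _ (fun t ht => ?_)
  have ht' : ((t : (AlgebraicClosure K)ˣ) : AlgebraicClosure K) ^ p ^ n = 1 := by
    have := congrArg Units.val ((mem_rootsOfUnity _ t).mp ht)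
    simpa using this
  have hιt : ι (t : AlgebraicClosure K) ^ p ^ n = 1 := by rw [← map_pow, ht', map_one]
  apply ι.toRingHom.injective
  change ι ((show AlgebraicClosure K ≃ₐ[K] AlgebraicClosure K from resGalAuxOfEmb ι τ) t) = ι _
  rw [apply_resGalAuxOfEmb_apply, map_pow]
  exact GaloisRep.cyclotomicCharacter_spec E p τ (ι t) hιt

end Restriction

/-! ## §4 `ker χ_p ≤ Gal(ℚ̄/K₀)` and `ker χ_p ≤ Gal(ℚ̄/K₀·ℚ_∞)` for `K₀ = ℚ(μ_p)` -/

section Kernel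

variable (p : ℕ) [Fact p.Prime] (K₀ : Type) [Field K₀] [NumberField K₀]
  [IsCyclotomicExtension {p} ℚ K₀]

/-- **`ker χ_p ≤ Gal(ℚ̄/K₀)`** for a `p`-th cyclotomic field `K₀`: an element of `Γ_ℚ` fixing the
`p`-power roots of unity of `ℚ̄` fixes the normal closure of (the copy of) `K₀ = ℚ(ζ_p)` in `ℚ̄`
pointwise — every conjugate `f(K₀) = ℚ(f ζ_p)` is generated by a `p`-th root of unity — hence lies
in `Γ_{K̃₀} ≤ galRange K₀` (`galSubgroupClosure_le_galRange`).
[cite: Washington1997, §13.1 (ℚ(μ_p) ⊂ ℚ(μ_{p^∞}))] -/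
theorem mem_galRange_of_cyclotomicCharacter_eq_one {σ : absoluteGaloisGroup ℚ}
    (hσ : GaloisRep.cyclotomicCharacter ℚ p σ = 1) : σ ∈ galRange (K := ℚ) K₀ := by
  have hp : p.Prime := Fact.out
  haveI : NeZero p := ⟨hp.ne_zero⟩
  apply galSubgroupClosure_le_galRange (K := ℚ) K₀
  let σ' : AlgebraicClosure ℚ ≃ₐ[ℚ] AlgebraicClosure ℚ := σ
  obtain ⟨ζ, hζ⟩ := IsCyclotomicExtension.exists_isPrimitiveRoot ℚ K₀ (Set.mem_singleton p)
    hp.ne_zero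
  have htop : Algebra.adjoin ℚ ({ζ} : Set K₀) = ⊤ :=
    IsCyclotomicExtension.adjoin_primitive_root_eq_top hζ
  -- `σ` fixes `f ζ` for every embedding `f : K₀ → ℚ̄`, hence `f(K₀) = ℚ(f ζ)` pointwise
  have hfix : ∀ (f : K₀ →ₐ[ℚ] AlgebraicClosure ℚ) (y : K₀), σ' (f y) = f y := by
    intro f y
    have hy : y ∈ Algebra.adjoin ℚ ({ζ} : Set K₀) := htop ▸ Algebra.mem_top
    rw [Algebra.adjoin_singleton_eq_range_aeval] at hy
    obtain ⟨q, rfl⟩ := hy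
    have hζ1 : σ' (f ζ) = f ζ := by
      have h1 : (f ζ) ^ p ^ 1 = 1 := by rw [pow_one, ← map_pow, hζ.pow_eq_one, map_one]
      exact GaloisRep.smul_eq_self_of_cyclotomicCharacter_eq_one ℚ p hσ 1 (f ζ) h1
    change (σ' : AlgebraicClosure ℚ →ₐ[ℚ] AlgebraicClosure ℚ) (f (aeval ζ q)) = f (aeval ζ q)
    rw [← aeval_algHom_apply f,
      ← aeval_algHom_apply (σ' : AlgebraicClosure ℚ →ₐ[ℚ] AlgebraicClosure ℚ)]
    change aeval (σ' (f ζ)) q = aeval (f ζ) q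
    rw [hζ1]
  -- hence the normal closure `K̃₀ = ⨆_f f(K₀)` of `K₀` in `ℚ̄` lies in the fixed field of `σ`
  have hle : IntermediateField.normalClosure ℚ K₀ (AlgebraicClosure ℚ) ≤
      IntermediateField.fixedField (Subgroup.zpowers σ') := by
    rw [normalClosure_le_iff]
    intro f
    rintro _ ⟨y, rfl⟩
    rw [IntermediateField.mem_fixedField_iff]
    intro g hg
    obtain ⟨k, rfl⟩ := Subgroup.mem_zpowers_iff.mp hg
    exact MulAction.fixedBy_subset_fixedBy_zpow (AlgebraicClosure ℚ) σ' k (hfix f y)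
  have hmem : σ' ∈ (galoisClosureIn (K := ℚ) K₀).fixingSubgroup := by
    refine (IntermediateField.mem_fixingSubgroup_iff _ _).mpr fun x hx => ?_
    have hx' := hle hx
    rw [IntermediateField.mem_fixedField_iff] at hx'
    exact hx' σ' (Subgroup.mem_zpowers σ')
  exact hmem

variable (κ : ZpExtension ℚ p)

/-- **`ker χ_p ≤ Gal(ℚ̄/K₀·ℚ_∞) = ker κ ⊓ Gal(ℚ̄/K₀)`** for the cyclotomic `ℤ_p`-extension `κ`
(`ker κ = χ_p⁻¹(μ(ℤ_p)) ⊇ ker χ_p` by definition of `IsCyclotomic`) and a `p`-th cyclotomic field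
`K₀` (`mem_galRange_of_cyclotomicCharacter_eq_one`). [cite: Kobayashi2003, §2 p. 4 (K_∞ = ℚ(μ_{p^∞}))] -/
theorem mem_towerTopSubgroup_of_cyclotomicCharacter_eq_one (hκ : κ.IsCyclotomic)
    {σ : absoluteGaloisGroup ℚ} (hσ : GaloisRep.cyclotomicCharacter ℚ p σ = 1) :
    σ ∈ towerTopSubgroup κ K₀ := by
  rw [mem_towerTopSubgroup_iff]
  refine ⟨?_, mem_galRange_of_cyclotomicCharacter_eq_one p K₀ hσ⟩
  have h : σ ∈ (CommGroup.torsion ℤ_[p]ˣ).comap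
      (GaloisRep.cyclotomicCharacter ℚ p).toMonoidHom := by
    rw [Subgroup.mem_comap]
    change GaloisRep.cyclotomicCharacter ℚ p σ ∈ CommGroup.torsion ℤ_[p]ˣ
    rw [hσ]
    exact one_mem _
  unfold IsCyclotomic at hκ
  rw [hκ]
  exact h

end Kernel

/-! ## §5 (D0) at the model `ℚ_[p]`: the decomposition group surjects onto `Gal(K₀·ℚ_∞/ℚ)` -/

section Padic

variable (p : ℕ) [Fact p.Prime] (κ : ZpExtension ℚ p) (K₀ : Type) [Field K₀] [NumberField K₀]
  [IsCyclotomicExtension {p} ℚ K₀]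

/-- **(D0) `LocalTowerHyp K₀ p κ ℚ_[p]`, unfolded: `K₀·ℚ_∞ = ℚ(μ_{p^∞})` is totally ramified at
`p`.** For the cyclotomic `ℤ_p`-extension `κ` of `ℚ` and a `p`-th cyclotomic field `K₀`, every
`g ∈ Γ_ℚ` is congruent modulo `Gal(ℚ̄/K₀·ℚ_∞) = towerTopSubgroup κ K₀` to an element of the
decomposition group `res(Γ_{ℚ_p})` of the chosen embedding `closureEmb ℚ_[p] : ℚ̄ → ℚ̄_p`:
pick `τ ∈ Γ_{ℚ_p}` with `χ_p(τ) = χ_p(g)` (`cyclotomicCharacter_padic_surjective`); then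
`χ_p(res(τ)⁻¹ g) = 1` (`cyclotomicCharacter_resGalOfEmb`) and `ker χ_p ≤ towerTopSubgroup κ K₀`.
[cite: Kobayashi2003, §2 p. 4 ("the prime p is totally ramified in K_n")]
[cite: NeukirchANT1999, Ch. II Prop. (7.13)] -/
theorem localTowerHyp_padic (hκ : κ.IsCyclotomic) (g : absoluteGaloisGroup ℚ) :
    ∃ τ : absoluteGaloisGroup ℚ_[p],
      (resGalOfEmb (closureEmb (K := ℚ) ℚ_[p]) τ)⁻¹ * g ∈ towerTopSubgroup κ K₀ := by
  obtain ⟨τ, hτ⟩ := cyclotomicCharacter_padic_surjective p (GaloisRep.cyclotomicCharacter ℚ p g)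
  refine ⟨τ, mem_towerTopSubgroup_of_cyclotomicCharacter_eq_one p K₀ κ hκ ?_⟩
  rw [map_mul, map_inv, cyclotomicCharacter_resGalOfEmb, hτ, inv_mul_cancel]

end Padic

end Summit.BirchSwinnertonDyer.Rank1Residual.Additive.SignedTwist
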